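import Mathlib
import Summits.Ventures.HodgeRepro.OcticCMPointInertGauss
import Summits.Ventures.HodgeRepro.OcticCMPointTameModel
import Summits.Ventures.HodgeRepro.OcticCMPointDualSign
import Summits.Ventures.HodgeRepro.OcticCMPointTruncThreeSign
import Summits.Ventures.HodgeRepro.OcticCMPointTruncFour

/-!
# OcticCMPointS3SignsExact — the root numbers of the octic point at `S₃` in closed form, in one statement

Blind re-derivation cell `pub-hodge-repro`, seat night-2 (gen 4).  Target tree path
`lean/Summits/Ventures/HodgeRepro/OcticCMPointS3SignsExact.lean`.  The exact companion of
`OcticCMPointS3Signs.lean` (which only says `±1`): for the standard additive characters (`ψ₅ = ζ₅^x` at `𝔭 | 5`,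
`(−1)^{Tr x}` at `𝔮 | 2`) the conductor-`1`, `2`, `3`, `4` root numbers of the transcribed rings are
**closed-form expressions with no sign ambiguity**:

* **`S3_signs_exact`** —
  (i) `𝔮 | 2`, conductor `1`: `ε(½, ω, ψ̃) = ω(ϖ)^n` for every non-trivial conjugate-dual tame `ω`
  (`OcticCMPointInertGauss`: `𝔤 = +4`);
  (ii) `𝔭 | 5`, conductor `1`: `ε(½, ⟨χ_quad, ω(ϖ)⟩, ψ₅) = ω(ϖ)^n` (`OcticCMPointTameModel`: Gauss's sign `+√5`);
  (iii) `𝔭 | 5`, conductor `2`: `ε(½, ω, ψ̃) = ω(ϖ)^n θ(β)` with `θ(β)² = 1` for every conjugate-dual `ω` of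
  conductor exactly `2` (`OcticCMPointDualSign`);
  (iv) `𝔭 | 5`, conductor `3`, the explicit twist: `ε(½, ρ, ψ̃₅) = −ρ(ϖ)^n` (`OcticCMPointTruncThreePsi5`:
  the quadratic Gauss sum `G(χ_quad, ψ₅(·/2)) = −√5`);
  (v) `𝔭 | 5`, conductor `4`, the explicit twist: `ε(½, ρ, ψ̃) = ρ(ϖ)^n` for every primitive `ψ₀`
  (`OcticCMPointTruncFour`: the Gauss sum is `|k|²`).

So at the standard characters the `ψ_δ`-dependence of ROUTE-B §9.9 (f) is visible on the nose: the twist's root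
number is `+ρ(ϖ)^n` at the even conductor `4` and `−ρ(ϖ)^n` at the odd conductor `3`.

* **`p5_signs_every_psi`** — the same at `𝔭 | 5` for EVERY primitive `ψ₀`: `ψ₀ = ψ₅(a ·)` with `a ≠ 0`, and the
  conductor-`1`, `3`, `4` root numbers are `χ_quad(a) ω(ϖ)^n`, `−χ_quad(a) ρ(ϖ)^n`, `ρ(ϖ)^n`
  (`OcticCMPointTruncThreeSign`): the `ψ_δ`-dependence at the odd conductors is the Legendre symbol of the
  scaling, and there is none at the even conductor.

**What this is not.**  The four `χ′_j` of the octic face are on no page — these are the values for the whole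
families named; `c ≥ 5` at `𝔭 | 5` and `c ≥ 2` at `𝔮` are not covered.  Nothing here says anything about the
status of the Hodge conjecture for CM abelian varieties, which is NOT proved.
-/

set_option autoImplicit false

noncomputable section

namespace Summit.Ventures.HodgeRepro.PeriodCloser

open GaussSumStability

/-- **The root numbers of the octic point at `S₃` in closed form** — see the module docstring for the five
clauses. -/
theorem S3_signs_exact (n : ℕ) :
    (∀ ω : LocalChar InertModel.F16, ω.unit ≠ 1 → (∀ x, ω.unit (InertModel.conj x) = ω.unit⁻¹ x) →
        LocalChar.eps (1 / 4) n ω (InertModel.psiTilde InertModel.psi0) = ω.piVal ^ n) ∧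
    (∀ π : ℂ, LocalChar.eps (((Real.sqrt 5)⁻¹ : ℝ) : ℂ) n (⟨TameModel.quadChar5, π⟩ : LocalChar (ZMod 5))
        TameModel.psi5 = π ^ n) ∧
    (∀ (ψ₀ : AddChar (ZMod 5) ℂ), ψ₀.IsPrimitive → ∀ (ω : LocalChar (DualNumber (ZMod 5))),
        (∃ z₀ ∈ DualModel.maxIdeal (ZMod 5), ω.unit (1 + z₀) ≠ 1) →
        (∀ x, ω.unit (DualModel.conj (ZMod 5) x) = ω.unit⁻¹ x) → ω.piVal ^ 2 = ω.unit (-1) →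
        Even n →
        ∃ θ : MulChar (ZMod 5) ℂ, ∃ β : ZMod 5, β ≠ 0 ∧ ω.unit = DualModel.tameWild θ β ψ₀ ∧ θ β * θ β = 1 ∧
          LocalChar.eps ((1 / 5 : ℝ) : ℂ) n ω (DualModel.psiTilde ψ₀) = ω.piVal ^ n * θ β) ∧
    (∀ π : ℂ, LocalChar.eps (((5 * Real.sqrt 5)⁻¹ : ℝ) : ℂ) n
        (⟨TruncModel.twist 3 (by norm_num) (by norm_num) (by decide) (by decide) 1 TameModel.psi5, π⟩ :
          LocalChar (TruncModel.Trunc (ZMod 5) 3)) (TruncModel.psiTilde 3 TameModel.psi5) = -π ^ n) ∧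
    (∀ (ψ₀ : AddChar (ZMod 5) ℂ), ψ₀.IsPrimitive → ∀ π : ℂ,
        LocalChar.eps ((1 / 25 : ℝ) : ℂ) n
          (⟨TruncModel.twist 4 (by norm_num) (by norm_num) (by decide) (by decide) 1 ψ₀, π⟩ :
            LocalChar (TruncModel.Trunc (ZMod 5) 4)) (TruncModel.psiTilde 4 ψ₀) = π ^ n) := by
  refine ⟨?_, ?_, ?_, ?_, ?_⟩
  · intro ω hω hσ
    exact InertModel.eps_eq_piVal_pow_psi0 n ω hω hσ
  · intro π
    exact TameModel.eps_quad_psi5 n π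
  · intro ψ₀ h₀ ω hcond hσω hπ2 hn
    obtain ⟨θ, β, hβ, hωeq, hθ, heps, -⟩ :=
      DualModel.eps_sign_of_conductor_two ω ψ₀ h₀ hcond hσω hπ2 n hn _ DualModel.kappa_mul_card_p5
    exact ⟨θ, β, hβ, hωeq, hθ, heps⟩
  · intro π
    exact TruncModel.eps_twist_three_psi5 n π
  · intro ψ₀ h₀ π
    exact TruncModel.eps_twist_four_half (by decide) (by decide) ψ₀ h₀ _ TruncModel.kappa_mul_card_sq_p5 n π

/-- **The root numbers at `𝔭 | 5` for every primitive `ψ₀`, in closed form**: `ψ₀ = ψ₅(a ·)` with `a ≠ 0`, and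
(i) conductor `1`: `ε(½, ⟨χ_quad, ω(ϖ)⟩, ψ₀) = χ_quad(a) ω(ϖ)^n`; (ii) conductor `3`, the explicit twist:
`ε(½, ρ, ψ̃₀) = −χ_quad(a) ρ(ϖ)^n`; (iii) conductor `4`, the explicit twist: `ε(½, ρ, ψ̃₀) = ρ(ϖ)^n`. -/
theorem p5_signs_every_psi (ψ₀ : AddChar (ZMod 5) ℂ) (h₀ : ψ₀.IsPrimitive) (n : ℕ) :
    ∃ a : ZMod 5, a ≠ 0 ∧ ψ₀ = AddChar.mulShift TameModel.psi5 a ∧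
      (∀ π : ℂ, LocalChar.eps (((Real.sqrt 5)⁻¹ : ℝ) : ℂ) n (⟨TameModel.quadChar5, π⟩ : LocalChar (ZMod 5)) ψ₀ =
        TameModel.quadChar5 a * π ^ n) ∧
      (∀ π : ℂ, LocalChar.eps (((5 * Real.sqrt 5)⁻¹ : ℝ) : ℂ) n
        (⟨TruncModel.twist 3 (by norm_num) (by norm_num) (by decide) (by decide) 1 ψ₀, π⟩ :
          LocalChar (TruncModel.Trunc (ZMod 5) 3)) (TruncModel.psiTilde 3 ψ₀) = -(TameModel.quadChar5 a * π ^ n)) ∧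
      (∀ π : ℂ, LocalChar.eps ((1 / 25 : ℝ) : ℂ) n
        (⟨TruncModel.twist 4 (by norm_num) (by norm_num) (by decide) (by decide) 1 ψ₀, π⟩ :
          LocalChar (TruncModel.Trunc (ZMod 5) 4)) (TruncModel.psiTilde 4 ψ₀) = π ^ n) := by
  obtain ⟨a, ha, rfl⟩ := TruncModel.exists_eq_mulShift_psi5 ψ₀ h₀
  exact ⟨a, ha, rfl, fun π => TruncModel.eps_quad_mulShift a ha n π,
    fun π => TruncModel.eps_twist_three_mulShift a ha n π,
    fun π => TruncModel.eps_twist_four_half (by decide) (by decide) _ (TruncModel.mulShift_psi5_isPrimitive a ha) _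
      TruncModel.kappa_mul_card_sq_p5 n π⟩

end Summit.Ventures.HodgeRepro.PeriodCloser

end
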